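import Mathlib
import HarnessLib
import Literature.Analysis.FluidPDE.AxisymmetricEuler
import Literature.Analysis.FluidPDE.SwirlTransportProofs
import Literature.Analysis.FluidPDE.AxisymSwirlGradientCurl

/-!
# Route `ThreadingFlux`, item `PoloidalLiouville` (W1, stmt-NavierStokesRegularity-1222) — crux idea «precession-gap» (ns-idea-15,
# `Cruxes/PoloidalLiouville/PrecessionSketch.lean` v2), piece E: THE SWIRL LEMMA `UnthreadedAxisymmetricNoSwirl`

Cell ns-regularity-ideate, seat ns-poloidal-K2-p2 g12 (hand for the precession rungs F/G per DIRECTOR-NS #264/#267/#270; `--supports`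
the W1 item).  Statement = the sketch's `Precession.UnthreadedAxisymmetricNoSwirl` with its local definition `IsUnthreadedAbout x₀ V`
(`∀ x, ⟪x − x₀, curl V x⟫ = 0`) unfolded (Theorems files cannot import the Cruxes sketch).

**`unthreadedAxisymmetricNoSwirl`**: an axisymmetric `C¹` field `V` whose vorticity is tangent to the spheres about a point `(0,0,c)` OF THE
AXIS has no swirl.  PROOF.  Majda–Bertozzi (2.64) in the tree's Cartesian form (`IsAxisymmetric.fderiv_swirl_apply_eq_curl`):
`DΓ(y)h = ω₂(y)(y₀h₀ + y₁h₁) − (y₀ω₀ + y₁ω₁)h₂` for the swirl `Γ = x₀V₁ − x₁V₀`; with `⟪y − c e₂, ω(y)⟫ = 0` this is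
`DΓ(y)h = ω₂(y)·⟪y − c e₂, h⟫`, so `Γ` has zero derivative along every direction tangent to the sphere about `c e₂` through `y`.  Along the
great-circle arc `s ↦ c e₂ + cos s · ρe₂ + sin s · w` (`w` horizontal, `‖w‖ = ρ`) from the pole `c e₂ + ρ e₂` (on the axis, where `Γ = 0`)
to any given point `x` (`ρ = ‖x − c e₂‖`, `s* = arccos((x₂ − c)/ρ)`), `Γ` is therefore constant, hence `Γ(x) = 0`.

WHAT THIS IS NOT: not a claim about Navier–Stokes regularity — an S-sized kinematic piece of a CONDITIONAL rung (fast-precessing relative equilibria)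
of W1; items 1222 / 27585 stay OPEN.
-/

noncomputable section

-- the summit and its single sub-problem share the name (CONVENTIONS §1), as in every Theorems file
set_option linter.dupNamespace false

namespace Summit.NavierStokesRegularity.NavierStokesRegularity.Theorems.ThreadingFluxPoloidalLiouvillePrecessionSwirl

open Set Function Filter Topology Metric
open scoped RealInnerProductSpace InnerProductSpace
open Literature.Analysis.FluidPDE

/-- `⟪y − c e₂, ω⟫` in coordinates. [folklore] -/
theorem inner_sub_single_two (y ω : EuclideanSpace ℝ (Fin 3)) (c : ℝ) :
    inner ℝ (y - EuclideanSpace.single 2 c) ω = y 0 * ω 0 + y 1 * ω 1 + (y 2 - c) * ω 2 := by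
  simp [EuclideanSpace.inner_eq_star_dotProduct, Fin.sum_univ_three, dotProduct]
  ring

/-- **The swirl gradient of an axisymmetric field unthreaded about `(0,0,c)`**: `DΓ(y)h = ω₂(y)·⟪y − c e₂, h⟫` (Majda–Bertozzi (2.64)
+ the unthreading relation `y₀ω₀ + y₁ω₁ = −(y₂ − c)ω₂`). [folklore] -/
theorem fderiv_swirl_apply_of_unthreaded {V : EuclideanSpace ℝ (Fin 3) → EuclideanSpace ℝ (Fin 3)} (hax : IsAxisymmetric V)
    {y : EuclideanSpace ℝ (Fin 3)} (hd : DifferentiableAt ℝ V y) {c : ℝ}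
    (hun : inner ℝ (y - EuclideanSpace.single 2 c) (curl V y) = 0) (h : EuclideanSpace ℝ (Fin 3)) :
    fderiv ℝ (swirl V) y h = curl V y 2 * (y 0 * h 0 + y 1 * h 1 + (y 2 - c) * h 2) := by
  rw [hax.fderiv_swirl_apply_eq_curl hd h]
  rw [inner_sub_single_two] at hun
  have : y 0 * curl V y 0 + y 1 * curl V y 1 = -((y 2 - c) * curl V y 2) := by linarith
  rw [this]; ring

/-- **THE SWIRL LEMMA (E of «precession-gap», `UnthreadedAxisymmetricNoSwirl` with `IsUnthreadedAbout` unfolded): an axisymmetric `C¹` field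
whose vorticity is tangent to the spheres about a point `(0,0,c)` of the axis has no swirl.** [folklore] -/
theorem unthreadedAxisymmetricNoSwirl :
    ∀ (V : EuclideanSpace ℝ (Fin 3) → EuclideanSpace ℝ (Fin 3)) (c : ℝ), ContDiff ℝ 1 V → IsAxisymmetric V →
      (∀ x, inner ℝ (x - EuclideanSpace.single (2 : Fin 3) c) (curl V x) = 0) → HasNoSwirl V := by
  intro V c hV hax hun x
  have hVd : Differentiable ℝ V := hV.differentiable one_ne_zero
  have hΓd : Differentiable ℝ (swirl V) := fun y => differentiableAt_swirl (hVd y)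
  set ctr : EuclideanSpace ℝ (Fin 3) := EuclideanSpace.single 2 c with hctr
  set e2 : EuclideanSpace ℝ (Fin 3) := EuclideanSpace.single 2 1 with he2
  -- the point relative to the centre
  set a : EuclideanSpace ℝ (Fin 3) := x - ctr with ha
  have ha0 : a 0 = x 0 := by simp [ha, hctr]
  have ha1 : a 1 = x 1 := by simp [ha, hctr]
  have ha2 : a 2 = x 2 - c := by simp [ha, hctr]
  -- on the axis the swirl vanishes
  by_cases haxis : x 0 = 0 ∧ x 1 = 0
  · show swirl V x = 0
    simp [swirl, haxis.1, haxis.2]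
  -- off the axis: the great-circle arc from the pole to `x`
  set m : ℝ := Real.sqrt (x 0 ^ 2 + x 1 ^ 2) with hm
  have hm2pos : 0 < x 0 ^ 2 + x 1 ^ 2 := by
    rcases not_and_or.1 haxis with h | h
    · have := sq_pos_of_ne_zero h; positivity
    · have := sq_pos_of_ne_zero h; positivity
  have hmpos : 0 < m := Real.sqrt_pos.2 hm2pos
  have hmsq : m ^ 2 = x 0 ^ 2 + x 1 ^ 2 := Real.sq_sqrt hm2pos.le
  set ρ : ℝ := Real.sqrt (x 0 ^ 2 + x 1 ^ 2 + (x 2 - c) ^ 2) with hρ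
  have hρ2pos : 0 < x 0 ^ 2 + x 1 ^ 2 + (x 2 - c) ^ 2 := by positivity
  have hρpos : 0 < ρ := Real.sqrt_pos.2 hρ2pos
  have hρsq : ρ ^ 2 = x 0 ^ 2 + x 1 ^ 2 + (x 2 - c) ^ 2 := Real.sq_sqrt hρ2pos.le
  -- the horizontal vector `w` of length `ρ` in the direction of `(x₀, x₁, 0)`
  set w : EuclideanSpace ℝ (Fin 3) := (ρ / m) • (EuclideanSpace.single 0 (x 0) + EuclideanSpace.single 1 (x 1)) with hw
  have hw0 : w 0 = ρ / m * x 0 := by simp [hw]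
  have hw1 : w 1 = ρ / m * x 1 := by simp [hw]
  have hw2 : w 2 = 0 := by simp [hw]
  -- the arc
  set γ : ℝ → EuclideanSpace ℝ (Fin 3) := fun s => ctr + (Real.cos s * ρ) • e2 + Real.sin s • w with hγ
  have hγ0c : ∀ s, γ s 0 = Real.sin s * w 0 := fun s => by simp [hγ, hctr, he2]
  have hγ1c : ∀ s, γ s 1 = Real.sin s * w 1 := fun s => by simp [hγ, hctr, he2]
  have hγ2c : ∀ s, γ s 2 = c + Real.cos s * ρ := fun s => by simp [hγ, hctr, he2, hw2]
  have hγd : ∀ s, HasDerivAt γ ((-Real.sin s * ρ) • e2 + Real.cos s • w) s := by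
    intro s
    have h1 : HasDerivAt (fun s => (Real.cos s * ρ) • e2) ((-Real.sin s * ρ) • e2) s :=
      ((Real.hasDerivAt_cos s).mul_const ρ).smul_const e2
    have h2 : HasDerivAt (fun s => Real.sin s • w) (Real.cos s • w) s := (Real.hasDerivAt_sin s).smul_const w
    have h3 : HasDerivAt (fun s => ctr + ((Real.cos s * ρ) • e2 + Real.sin s • w)) ((-Real.sin s * ρ) • e2 + Real.cos s • w) s :=
      (h1.add h2).const_add ctr
    have e : γ = fun s => ctr + ((Real.cos s * ρ) • e2 + Real.sin s • w) := by
      funext s; simp only [hγ, add_assoc]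
    rw [e]; exact h3
  -- the swirl is constant along the arc
  have hconst : ∀ s, HasDerivAt (fun s => swirl V (γ s)) 0 s := by
    intro s
    have h := (hΓd (γ s)).hasFDerivAt.comp_hasDerivAt s (hγd s)
    have hval : fderiv ℝ (swirl V) (γ s) ((-Real.sin s * ρ) • e2 + Real.cos s • w) = 0 := by
      rw [fderiv_swirl_apply_of_unthreaded hax (hVd _) (hun (γ s)), hγ0c, hγ1c, hγ2c]
      have e0 : ((-Real.sin s * ρ) • e2 + Real.cos s • w) 0 = Real.cos s * w 0 := by simp [he2]
      have e1 : ((-Real.sin s * ρ) • e2 + Real.cos s • w) 1 = Real.cos s * w 1 := by simp [he2]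
      have e2' : ((-Real.sin s * ρ) • e2 + Real.cos s • w) 2 = -Real.sin s * ρ := by simp [he2, hw2]
      rw [e0, e1, e2', hw0, hw1]
      have hww : (ρ / m * x 0) ^ 2 + (ρ / m * x 1) ^ 2 = ρ ^ 2 := by
        rw [mul_pow, mul_pow, ← mul_add, ← hmsq, div_pow, div_mul_cancel₀ _ (pow_ne_zero 2 hmpos.ne')]
      have : Real.sin s * (ρ / m * x 0) * (Real.cos s * (ρ / m * x 0)) +
          Real.sin s * (ρ / m * x 1) * (Real.cos s * (ρ / m * x 1)) + (c + Real.cos s * ρ - c) * (-Real.sin s * ρ) =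
          Real.sin s * Real.cos s * ((ρ / m * x 0) ^ 2 + (ρ / m * x 1) ^ 2 - ρ ^ 2) := by ring
      rw [this, hww, sub_self, mul_zero, mul_zero]
    rwa [hval] at h
  have hΓconst := is_const_of_deriv_eq_zero (fun s => (hconst s).differentiableAt) (fun s => (hconst s).deriv)
  -- the pole is on the axis
  have hpole : swirl V (γ 0) = 0 := by
    have h0 : γ 0 0 = 0 := by rw [hγ0c, Real.sin_zero, zero_mul]
    have h1 : γ 0 1 = 0 := by rw [hγ1c, Real.sin_zero, zero_mul]
    simp [swirl, h0, h1]
  -- the point `x` is on the arc: `s* = arccos ((x₂ - c)/ρ)`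
  set s₀ : ℝ := Real.arccos ((x 2 - c) / ρ) with hs₀
  have hquot : -1 ≤ (x 2 - c) / ρ ∧ (x 2 - c) / ρ ≤ 1 := by
    rw [← abs_le, abs_div, abs_of_pos hρpos, div_le_one hρpos]
    rw [← Real.sqrt_sq_eq_abs, hρ]
    exact Real.sqrt_le_sqrt (by nlinarith)
  have hcos : Real.cos s₀ = (x 2 - c) / ρ := by rw [hs₀, Real.cos_arccos hquot.1 hquot.2]
  have hsin : Real.sin s₀ = m / ρ := by
    rw [hs₀, Real.sin_arccos]
    have : 1 - ((x 2 - c) / ρ) ^ 2 = (m / ρ) ^ 2 := by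
      rw [div_pow, div_pow, hmsq]
      field_simp
      nlinarith [hρsq]
    rw [this, Real.sqrt_sq (div_nonneg hmpos.le hρpos.le)]
  have hxγ : γ s₀ = x := by
    ext i
    fin_cases i
    · show γ s₀ 0 = x 0
      rw [hγ0c, hsin, hw0]; field_simp
    · show γ s₀ 1 = x 1
      rw [hγ1c, hsin, hw1]; field_simp
    · show γ s₀ 2 = x 2
      rw [hγ2c, hcos]; field_simp; ring
  show swirl V x = 0
  rw [← hxγ, hΓconst s₀ 0, hpole]

end Summit.NavierStokesRegularity.NavierStokesRegularity.Theorems.ThreadingFluxPoloidalLiouvillePrecessionSwirl
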